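import Literature.MathematicalPhysics.KineticTheory.LangevinChainSDE
import HarnessLib

/-!
# The flow of the pinned chain depends continuously on the noise path

Trunk T-KINETIC (Literature/MathematicalPhysics/KineticTheory). A pathwise ingredient of the
support theorem for the Langevin-driven pinned chain (Cuneo–Eckmann–Hairer–Rey-Bellet 2018,
eq. (2.2); Cor. 3.4 and Remark 3.5: controllability of the associated control system, Stroock–
Varadhan support theorem), recorded for the provefact unit of
`CuneoEckmannHairerReyBellet2018_thm213` (irreducibility, CEHR Prop. 3.3, is one of the remaining
inputs of `LangevinChainSmallSets.lean`): because the noise of (2.2) is ADDITIVE, the solution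
`z_{x,η}(t) = chainFlow x η t` of the integral equation
`z(t) = x + (0, η(t)) + ∫₀ᵗ Y(z(s)) ds` (`LangevinChainSDE.lean`) is a LIPSCHITZ function of the
noise path `η` in the uniform norm on `[0, T]`, for initial conditions of bounded energy and noise
paths of bounded size:

* `pinnedChain_norm_chainFlow_sub_chainFlow_le` — if `‖η₁‖, ‖η₂‖ ≤ M` and `‖η₁ - η₂‖ ≤ δ` on
  `[0, T]`, then `‖z_{x,η₁}(t) - z_{x,η₂}(t)‖ ≤ δ e^{Kt}` on `[0, T]`, with `K` the Lipschitz
  constant of the drift truncated at the a-priori radius `R₀(H(x), M, T)` (both flows are the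
  Picard solutions of the truncated equation there, `pinnedChain_chainFlow_eqOn_truncSol`, and
  Grönwall's continuous dependence on the forcing,
  `Literature.Analysis.ODE.norm_forcedSolution_sub_le`, applies).
* `pinnedChain_exists_norm_chainFlow_sub_lt` — the `ε`-`δ` form: for every `ε > 0` there is
  `δ > 0` such that `sup_{[0,T]} ‖η₁ - η₂‖ ≤ δ` (and `‖η₂‖ ≤ M`) forces
  `‖z_{x,η₁}(t) - z_{x,η₂}(t)‖ < ε` on `[0, T]`, uniformly in `x` with `H(x) ≤ E₀` and in `η₁` with
  `‖η₁‖ ≤ M`.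

## References

* N. Cuneo, J.-P. Eckmann, M. Hairer, L. Rey-Bellet, EJP 23 (2018) no. 55, §2 (2.2), §3.1
  Cor. 3.4, Remark 3.5.
* D. W. Stroock, S. R. S. Varadhan, *On the support of diffusion processes with applications to
  the strong maximum principle*, Proc. Sixth Berkeley Symp. III (1972) 333–359.
* E. A. Coddington, N. Levinson, *Theory of Ordinary Differential Equations* (1955), Ch. 1 §5
  (continuous dependence).
-/

noncomputable section

open MeasureTheory Filter Topology Set Metric
open scoped NNReal

namespace Literature.MathematicalPhysics.KineticTheory.HeatConduction

open OscillatorChain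

variable {N : ℕ} {ω₂ lam β γ : ℝ}

/-- **The flow of the pinned chain is Lipschitz in the noise path** (uniform norm on `[0, T]`):
for `ω₂ > 0`, `lam, β, γ ≥ 0`, an initial condition `x`, continuous noise paths `η₁, η₂` with
`‖ηᵢ(t)‖ ≤ M` and `‖η₁(t) - η₂(t)‖ ≤ δ` on `[0, T]`, and every truncation radius `R` beyond the
a-priori radius `R₀(H(x), M, T)` with Lipschitz constant `K` of the truncated drift,
`‖z_{x,η₁}(t) - z_{x,η₂}(t)‖ ≤ δ e^{Kt}` for `t ∈ [0, T]`. [folklore] -/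
theorem pinnedChain_norm_chainFlow_sub_chainFlow_le (hω : 0 < ω₂) (hl : 0 ≤ lam) (hβ : 0 ≤ β)
    (hγ : 0 ≤ γ) (N : ℕ) (x : PhaseSpace N) {η₁ η₂ : ℝ → Fin N → ℝ} (hη₁ : Continuous η₁)
    (hη₂ : Continuous η₂) {T M δ : ℝ} (hM₁ : ∀ t ∈ Icc 0 T, ‖η₁ t‖ ≤ M)
    (hM₂ : ∀ t ∈ Icc 0 T, ‖η₂ t‖ ≤ M) (hδ : ∀ t ∈ Icc 0 T, ‖η₁ t - η₂ t‖ ≤ δ)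
    {R : ℝ} (hR : 0 < R)
    (hRR : pinnedChainRadius ω₂ lam β γ N ((pinnedChain ω₂ lam β γ).hamiltonian N x) M T ≤ R)
    {K : ℝ≥0} (hK : LipschitzWith K (truncateField R ((pinnedChain ω₂ lam β γ).drift N))) :
    ∀ t ∈ Icc 0 T, ‖(pinnedChain ω₂ lam β γ).chainFlow N x η₁ t -
        (pinnedChain ω₂ lam β γ).chainFlow N x η₂ t‖ ≤ δ * Real.exp (K * t) := by
  intro t ht
  rw [pinnedChain_chainFlow_eqOn_truncSol hω hl hβ hγ N hR x hη₁ hM₁ hRR ht,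
    pinnedChain_chainFlow_eqOn_truncSol hω hl hβ hγ N hR x hη₂ hM₂ hRR ht]
  unfold OscillatorChain.truncSol
  refine Literature.Analysis.ODE.norm_forcedSolution_sub_le hK (continuous_forcing x hη₁)
    (continuous_forcing x hη₂) (fun s hs => ?_) t ht
  have h : forcing x η₁ s - forcing x η₂ s = ((0 : Fin N → ℝ), η₁ s - η₂ s) := by
    simp only [forcing]
    ext i <;> simp
  rw [h, Prod.norm_def]
  simpa using hδ s hs

/-- **Continuity of the flow in the noise path, `ε`-`δ` form, uniform on bounded sets**: for
`E₀, M, T` and `ε > 0` there is `δ > 0` such that for every initial condition with `H(x) ≤ E₀`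
and all continuous noise paths `η₁, η₂` bounded by `M` on `[0, T]` with
`sup_{[0,T]} ‖η₁ - η₂‖ ≤ δ`, one has `‖z_{x,η₁}(t) - z_{x,η₂}(t)‖ < ε` on `[0, T]`. [folklore] -/
theorem pinnedChain_exists_norm_chainFlow_sub_lt (hω : 0 < ω₂) (hl : 0 ≤ lam) (hβ : 0 ≤ β)
    (hγ : 0 ≤ γ) (N : ℕ) (E₀ M T : ℝ) {ε : ℝ} (hε : 0 < ε) :
    ∃ δ : ℝ, 0 < δ ∧ ∀ (x : PhaseSpace N), (pinnedChain ω₂ lam β γ).hamiltonian N x ≤ E₀ →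
      ∀ (η₁ η₂ : ℝ → Fin N → ℝ), Continuous η₁ → Continuous η₂ →
        (∀ t ∈ Icc 0 T, ‖η₁ t‖ ≤ M) → (∀ t ∈ Icc 0 T, ‖η₂ t‖ ≤ M) →
        (∀ t ∈ Icc 0 T, ‖η₁ t - η₂ t‖ ≤ δ) →
        ∀ t ∈ Icc 0 T, ‖(pinnedChain ω₂ lam β γ).chainFlow N x η₁ t -
          (pinnedChain ω₂ lam β γ).chainFlow N x η₂ t‖ < ε := by
  -- one truncation radius for all initial conditions of energy `≤ E₀`
  set R : ℝ := max (pinnedChainRadius ω₂ lam β γ N E₀ M T) 1 with hRdef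
  have hR : 0 < R := lt_max_of_lt_right one_pos
  obtain ⟨K, hK⟩ := pinnedChain_exists_lipschitzWith_truncDrift ω₂ lam β γ N hR
  -- `δ e^{K max(T,0)} < ε`
  set L : ℝ := Real.exp (K * max T 0) with hL
  have hL0 : 0 < L := Real.exp_pos _
  refine ⟨ε / (2 * L), by positivity, fun x hx η₁ η₂ hη₁ hη₂ hM₁ hM₂ hδ t ht => ?_⟩
  have hRR : pinnedChainRadius ω₂ lam β γ N ((pinnedChain ω₂ lam β γ).hamiltonian N x) M T ≤ R :=
    (pinnedChainRadius_mono hω N hx).trans (le_max_left _ _)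
  have h := pinnedChain_norm_chainFlow_sub_chainFlow_le hω hl hβ hγ N x hη₁ hη₂ hM₁ hM₂ hδ hR hRR
    hK t ht
  have hexp : Real.exp (K * t) ≤ L := by
    rw [hL]
    exact Real.exp_le_exp.2 (mul_le_mul_of_nonneg_left (le_max_of_le_left ht.2) K.coe_nonneg)
  calc ‖(pinnedChain ω₂ lam β γ).chainFlow N x η₁ t - (pinnedChain ω₂ lam β γ).chainFlow N x η₂ t‖
      ≤ ε / (2 * L) * Real.exp (K * t) := h
    _ ≤ ε / (2 * L) * L := mul_le_mul_of_nonneg_left hexp (by positivity)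
    _ = ε / 2 := by field_simp
    _ < ε := half_lt_self hε

end Literature.MathematicalPhysics.KineticTheory.HeatConduction
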